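import Literature.Probability.RandomPlanarGeometry.CurveSpace
import HarnessLib

/-!
# No idling of the limit interface, part 6: counting many occurrences, and passage to the
weak limit

Helper file for the registered stub `stub_limitCurveRegularity_noIdle` of line
`hitting-tournament` of crux `LagHandOff` (stmt-CriticalPhenomena-10268).  The first-moment
step of the no-idling estimate, in abstract form:

* `isOpen_setOf_le_card_filter` — for finitely many open sets `U g`, `g ∈ T`, the event "at
  least `M` of them occur" is open;
* `mul_measure_setOf_le_card_filter_le` — **Markov's inequality for the number of occurring
  events**: `M · P(at least M of the A g occur) ≤ Σ_g P(A g)`;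
* `measure_le_liminf_measure_preimage_of_isOpen` — **portmanteau, open sets**, from the weak
  convergence of the laws of random elements `X n` tested on bounded continuous functions:
  `ν G ≤ liminf_n P(X n ∈ G)`;
* `measure_iInter_eq_zero_of_eventually_le` — if moreover open events `G k` have
  `P(X n ∈ G k) ≤ b k` for all large `n`, with `b k → 0`, then `ν (⋂ k, G k) = 0`.

References: P. Billingsley, *Convergence of probability measures*, 2nd ed. (1999), Thm. 2.1
(portmanteau); M. Aizenman, A. Burchard, Duke Math. J. 99 (1999), §2 (first-moment bounds for
curve functionals under weak limits).
-/

noncomputable section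

open MeasureTheory Filter Set Topology Metric
open scoped ENNReal BoundedContinuousFunction

namespace Summit.CriticalPhenomena.CardyFormulaZ2.Cruxes.LagHandOff.HittingTournament

/-! ### At least `M` of finitely many open events: an open event -/

/-- **"At least `M` of the open sets `U g`, `g ∈ T`, contain the point" is open.** Around a
point of the event, the finite intersection of the `U g` containing it is an open
neighbourhood inside the event. [folklore] -/
theorem isOpen_setOf_le_card_filter {Y G : Type*} [TopologicalSpace Y] [DecidableEq G]
    (T : Finset G) (U : G → Set Y) [∀ g y, Decidable (y ∈ U g)] (hU : ∀ g ∈ T, IsOpen (U g))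
    (M : ℕ) : IsOpen {y : Y | M ≤ (T.filter fun g => y ∈ U g).card} := by
  rw [isOpen_iff_forall_mem_open]
  intro y hy
  set S := T.filter fun g => y ∈ U g with hS
  refine ⟨⋂ g ∈ S, U g, fun y' hy' => ?_, isOpen_biInter_finset fun g hg =>
    hU g (Finset.mem_filter.1 hg).1, ?_⟩
  · have hsub : S ⊆ T.filter fun g => y' ∈ U g := by
      intro g hg
      refine Finset.mem_filter.2 ⟨(Finset.mem_filter.1 hg).1, ?_⟩
      exact Set.mem_iInter₂.1 hy' g hg
    exact le_trans hy (Finset.card_le_card hsub)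
  · exact Set.mem_iInter₂.2 fun g hg => (Finset.mem_filter.1 hg).2

/-! ### Markov's inequality for the number of occurring events -/

/-- **Markov's inequality for the number of occurring events**: for finitely many measurable
events `A g`, `g ∈ T`, and every `M`,
`M · P{ω | at least M of the A g contain ω} ≤ Σ_{g ∈ T} P(A g)` (the number of occurring
events, a sum of indicators, has integral `Σ P(A g)`). [folklore] -/
theorem mul_measure_setOf_le_card_filter_le {Ω G : Type*} [MeasurableSpace Ω] (P : Measure Ω)
    [DecidableEq G] (T : Finset G) (A : G → Set Ω) [∀ g ω, Decidable (ω ∈ A g)]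
    (hA : ∀ g ∈ T, MeasurableSet (A g)) (M : ℕ) :
    (M : ℝ≥0∞) * P {ω | M ≤ (T.filter fun g => ω ∈ A g).card} ≤ ∑ g ∈ T, P (A g) := by
  classical
  set f : Ω → ℝ≥0∞ := fun ω => ∑ g ∈ T, (A g).indicator 1 ω with hf
  have hfm : Measurable f :=
    Finset.measurable_sum _ fun g hg => (measurable_one.indicator (hA g hg))
  have hf_eq : ∀ ω, f ω = ((T.filter fun g => ω ∈ A g).card : ℝ≥0∞) := by
    intro ω
    rw [hf]
    simp only [Finset.card_filter, Nat.cast_sum, Nat.cast_ite, Nat.cast_one, Nat.cast_zero]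
    refine Finset.sum_congr rfl fun g _ => ?_
    by_cases h : ω ∈ A g <;> simp [h]
  have hset : {ω | M ≤ (T.filter fun g => ω ∈ A g).card} = {ω | (M : ℝ≥0∞) ≤ f ω} := by
    ext ω
    simp only [mem_setOf_eq, hf_eq, Nat.cast_le]
  have hint : ∫⁻ ω, f ω ∂P = ∑ g ∈ T, P (A g) := by
    rw [hf, lintegral_finsetSum _ fun g hg => measurable_one.indicator (hA g hg)]
    refine Finset.sum_congr rfl fun g hg => ?_
    rw [lintegral_indicator_one (hA g hg)]
  rw [hset, ← hint]
  exact mul_meas_ge_le_lintegral hfm _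

/-! ### Portmanteau for open sets, from bounded continuous test functions -/

/-- **Portmanteau, open sets.** If the laws of the random elements `X n` (measurable, under a
probability measure `P`) converge to the probability measure `ν` when tested on bounded
continuous functions, then `ν G ≤ liminf_n P(X n ∈ G)` for every open `G`. (Billingsley,
Thm. 2.1; via Mathlib's `ProbabilityMeasure.le_liminf_measure_open_of_tendsto`.) [folklore] -/
theorem measure_le_liminf_measure_preimage_of_isOpen {Ω Y : Type*} [MeasurableSpace Ω]
    {P : Measure Ω} [IsProbabilityMeasure P] [MetricSpace Y] [MeasurableSpace Y] [BorelSpace Y]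
    {X : ℕ → Ω → Y} (hX : ∀ n, Measurable (X n)) {ν : Measure Y} [IsProbabilityMeasure ν]
    (hlim : ∀ f : Y →ᵇ ℝ, Tendsto (fun n => ∫ ω, f (X n ω) ∂P) atTop (𝓝 (∫ y, f y ∂ν)))
    {G : Set Y} (hG : IsOpen G) :
    ν G ≤ atTop.liminf fun n => P (X n ⁻¹' G) := by
  set μs : ℕ → ProbabilityMeasure Y := fun n =>
    ⟨P.map (X n), Measure.isProbabilityMeasure_map (hX n).aemeasurable⟩ with hμs
  set μ : ProbabilityMeasure Y := ⟨ν, inferInstance⟩ with hμ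
  have htend : Tendsto μs atTop (𝓝 μ) := by
    rw [ProbabilityMeasure.tendsto_iff_forall_integral_tendsto]
    intro f
    have h1 : ∀ n, ∫ y, f y ∂(μs n : Measure Y) = ∫ ω, f (X n ω) ∂P := fun n => by
      show ∫ y, f y ∂(P.map (X n)) = ∫ ω, f (X n ω) ∂P
      exact integral_map (hX n).aemeasurable f.continuous.aestronglyMeasurable
    simp_rw [h1]
    exact hlim f
  have key := ProbabilityMeasure.le_liminf_measure_open_of_tendsto htend hG
  have h2 : ∀ n, ((μs n : ProbabilityMeasure Y) : Measure Y) G = P (X n ⁻¹' G) := fun n => by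
    show (P.map (X n)) G = P (X n ⁻¹' G)
    exact Measure.map_apply (hX n) hG.measurableSet
  simp_rw [h2] at key
  exact key

/-- **Null intersections from uniform bounds along the approximations.** In the setting of
`measure_le_liminf_measure_preimage_of_isOpen`, if the open events `G k` satisfy
`P(X n ∈ G k) ≤ b k` for all large `n`, and `b k → 0`, then `ν (⋂ k, G k) = 0`. [folklore] -/
theorem measure_iInter_eq_zero_of_eventually_le {Ω Y : Type*} [MeasurableSpace Ω]
    {P : Measure Ω} [IsProbabilityMeasure P] [MetricSpace Y] [MeasurableSpace Y] [BorelSpace Y]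
    {X : ℕ → Ω → Y} (hX : ∀ n, Measurable (X n)) {ν : Measure Y} [IsProbabilityMeasure ν]
    (hlim : ∀ f : Y →ᵇ ℝ, Tendsto (fun n => ∫ ω, f (X n ω) ∂P) atTop (𝓝 (∫ y, f y ∂ν)))
    {G : ℕ → Set Y} (hG : ∀ k, IsOpen (G k)) {b : ℕ → ℝ≥0∞}
    (hb : ∀ k, ∀ᶠ n in atTop, P (X n ⁻¹' G k) ≤ b k) (hb0 : Tendsto b atTop (𝓝 0)) :
    ν (⋂ k, G k) = 0 := by
  have hk : ∀ k, ν (⋂ k, G k) ≤ b k := by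
    intro k
    calc ν (⋂ k, G k) ≤ ν (G k) := measure_mono (iInter_subset _ k)
      _ ≤ atTop.liminf fun n => P (X n ⁻¹' G k) :=
          measure_le_liminf_measure_preimage_of_isOpen hX hlim (hG k)
      _ ≤ atTop.liminf fun _ : ℕ => b k := liminf_le_liminf (hb k)
      _ = b k := liminf_const _
  exact le_antisymm (ge_of_tendsto' hb0 hk) bot_le

/-- **Registered sub-stub `stub_noIdle_counting`** (line `hitting-tournament`, stub
`stub_limitCurveRegularity_noIdle`, helper 6): `measure_iInter_eq_zero_of_eventually_le` with
all arguments explicit. [folklore] -/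
theorem stub_noIdle_counting : ∀ (Ω Y : Type*) [MeasurableSpace Ω] (P : Measure Ω) [IsProbabilityMeasure P] [MetricSpace Y] [MeasurableSpace Y] [BorelSpace Y] (X : ℕ → Ω → Y), (∀ n, Measurable (X n)) → ∀ (ν : Measure Y) [IsProbabilityMeasure ν], (∀ f : BoundedContinuousFunction Y ℝ, Filter.Tendsto (fun n => ∫ ω, f (X n ω) ∂P) Filter.atTop (nhds (∫ y, f y ∂ν))) → ∀ (G : ℕ → Set Y), (∀ k, IsOpen (G k)) → ∀ (b : ℕ → ENNReal), (∀ k, ∀ᶠ n in Filter.atTop, P (X n ⁻¹' G k) ≤ b k) → Filter.Tendsto b Filter.atTop (nhds 0) → ν (⋂ k, G k) = 0 :=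
  fun _ _ _ _ _ _ _ _ _ hX _ _ hlim _ hG _ hb hb0 =>
    measure_iInter_eq_zero_of_eventually_le hX hlim hG hb hb0

end Summit.CriticalPhenomena.CardyFormulaZ2.Cruxes.LagHandOff.HittingTournament

end
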